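import Literature.Computability.Learning.CryptoHardnessMachine
import Literature.Computability.Learning.PACUniformCoins
import Literature.Computability.Learning.CryptoHardness
import HarnessLib

/-!
# A uniform PRF distinguisher built from a polynomial-time PAC learner: the two games

Probabilistic layer of the proof of the named fact
`Literature.Computability.Learning.prf_not_polyPACPredictable` (`CryptoHardness.lean`): the
acceptance probability of the adversary `LearnerDistinguisher.distinguisher A E qA P₁ P₂` of
`CryptoHardnessMachine.lean` — by `acceptProb_distinguisher` the uniform probability of the verdict
over its coin string `r = g₁ g₂ z₀ z₁ ρ S'` — is bounded in the two PRF games of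
`Cryptography/PseudorandomFunctions.lean`:

* **REAL** (`acceptProb_real_ge`): against an oracle whose first answer bit is a function `f` that
  the pair `(A, E)` PAC-learns with accuracy and confidence `1/8` using `c*` coins and `T*`, `T₂*`
  rounds, the adversary accepts with probability `≥ 1/2 + (7/32) · 2^{-(L₁+L₂)}`: conditioned on
  the coins outside the test blocks the verdict `[h(z₀) = f z₀ ↔ h(z₁) = f z₁]` has probability
  `α² + (1-α)² ≥ 1/2` (`α` the accuracy of the hypothesis `h`; `uniformProb_verdict_window_ge_half`),
  and `≥ 3/4` when `h` errs on `≤ 1/8` of the points; the guesses are right with probability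
  `2^{-(L₁+L₂)}`, and given that, the clocked learner inside the adversary sees exactly the oracle
  `pacOracle true f xs` of `PAC.lean` on uniform examples (`learnOut_eq_of_pacSuccess`), so the
  hypothesis is good with probability `≥ 7/8` (`PACUniformCoins.pacSuccessProb_uniform_eq_uniformProb`).
* **IDEAL** (`idealProb_le`): against a uniformly random function table `H : {0,1}ⁿ → {0,1}^ℓ`,
  `ℓ ≥ 1`, the average acceptance probability is `≤ 1/2 + (T' + 1)/2ⁿ` (`T'` the learner's round
  budget): for every FIXED coin string, flipping the first bit of `H` at the test point `z₀` is an
  involution of the tables that preserves the learner's whole run as long as the run never touched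
  `z₀` and `z₀ ≠ z₁` (locality, `runIdxAux_congr_of_points`) and flips the verdict — so among such
  tables at most half accept (`two_mul_card_accept_fresh_le`); and for every fixed table the test
  point `z₀`, a fresh uniform block, hits the `≤ T'` touched points or `z₁` with probability
  `≤ (T'+1)/2ⁿ` (`UniformProbBlocks.uniformProb_block_le'`).

This is the standard argument behind "learning implies distinguishing from random"
(Goldreich–Goldwasser–Micali 1986, §3 and Thm. 3 ("polling"); Kearns–Valiant 1994, §3;
Oliveira–Santhanam 2017, §4 Prop. 1), written out for the uniform, budget-guessing adversary.

## References

* O. Goldreich, S. Goldwasser, S. Micali, *How to construct random functions*, J. ACM 33 (1986)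
  792–807, §3 [GoldreichGoldwasserMicali1986].
* M. Kearns, L. Valiant, J. ACM 41 (1994) 67–95, §3 [KearnsValiant1994].
* I. C. Oliveira, R. Santhanam, CCC 2017 (arXiv:1611.01190), §4, Prop. 1 [OliveiraSanthanam2017].
* M. J. Kearns, U. V. Vazirani, *An Introduction to Computational Learning Theory*, MIT Press
  1994, §1.2, §8.1 [KearnsVazirani1994].
-/

noncomputable section

namespace Literature.Computability.Complexity

open _root_.Computability

namespace OracleAlg

variable {β : Type}

/-! ### Indexed runs: monotonicity in the fuel and locality in the oracle -/

/-- More fuel never changes a produced output (indexed runner). [Arora–Barak 2009, §3.4] [folklore] -/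
theorem runIdxAux_mono (M : OracleAlg β) (O : ℕ → List Bool → List Bool) (x : List Bool) {k k' : ℕ} (hk : k ≤ k')
    {as : List (List Bool)} {b : β} (h : M.runIdxAux O x k as = some b) : M.runIdxAux O x k' as = some b := by
  induction k generalizing k' as with
  | zero => simp [runIdxAux] at h
  | succ k ih =>
    obtain ⟨k', rfl⟩ := Nat.exists_eq_add_of_le hk
    rw [show k + 1 + k' = (k + k') + 1 by omega, runIdxAux_succ']
    rw [runIdxAux_succ'] at h
    cases hs : M.step x as with
    | inl q => rw [hs] at h; exact ih (Nat.le_add_right k k') h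
    | inr b' => rw [hs] at h; exact h

/-- **Locality in the index**: two indexed oracles agreeing at all indices below `|as| + k` give the same
run within `k` rounds from `as`. [Arora–Barak 2009, §3.4] [folklore] -/
theorem runIdxAux_congr_lt (M : OracleAlg β) (O O' : ℕ → List Bool → List Bool) (x : List Bool) :
    ∀ (k : ℕ) (as : List (List Bool)), (∀ j < as.length + k, ∀ q, O j q = O' j q) →
      M.runIdxAux O x k as = M.runIdxAux O' x k as
  | 0, _, _ => rfl
  | k + 1, as, h => by
    rw [runIdxAux_succ', runIdxAux_succ']
    cases M.step x as with
    | inr b => rfl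
    | inl q =>
      dsimp only
      rw [h as.length (by omega) q]
      exact runIdxAux_congr_lt M O O' x k _ fun j hj q' => h j (by simp at hj ⊢; omega) q'

/-- The POINTS of an indexed run: the point `pt j q` of each query `q` asked at index `j`, in order.
[Arora–Barak 2009, §3.4] [folklore] -/
def ptsIdxAux (M : OracleAlg β) (O : ℕ → List Bool → List Bool) (pt : ℕ → List Bool → List Bool) (x : List Bool) :
    ℕ → List (List Bool) → List (List Bool)
  | 0, _ => []
  | k + 1, as =>
    match M.step x as with
    | Sum.inl q => pt as.length q :: ptsIdxAux M O pt x k (as ++ [O as.length q])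
    | Sum.inr _ => []

/-- At most `k` points within `k` rounds. [folklore] -/
theorem length_ptsIdxAux_le (M : OracleAlg β) (O : ℕ → List Bool → List Bool) (pt : ℕ → List Bool → List Bool)
    (x : List Bool) : ∀ (k : ℕ) (as : List (List Bool)), (M.ptsIdxAux O pt x k as).length ≤ k
  | 0, _ => by simp [ptsIdxAux]
  | k + 1, as => by
    unfold ptsIdxAux
    cases M.step x as with
    | inr b => simp
    | inl q => simpa using length_ptsIdxAux_le M O pt x k _

/-- **Locality in the points**: if two indexed oracles agree on every query whose point is not `z`, and
the run against the first never touches the point `z`, then the two runs — outputs and points — agree.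
[Arora–Barak 2009, §3.4; GGM 1986, §3 (the polling argument)] [folklore] -/
theorem runIdxAux_congr_of_points (M : OracleAlg β) (O O' : ℕ → List Bool → List Bool)
    (pt : ℕ → List Bool → List Bool) (z : List Bool) (x : List Bool)
    (hO : ∀ j q, pt j q ≠ z → O j q = O' j q) :
    ∀ (k : ℕ) (as : List (List Bool)), z ∉ M.ptsIdxAux O pt x k as →
      M.runIdxAux O x k as = M.runIdxAux O' x k as ∧ M.ptsIdxAux O pt x k as = M.ptsIdxAux O' pt x k as
  | 0, _, _ => ⟨rfl, rfl⟩
  | k + 1, as, hz => by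
    rw [runIdxAux_succ', runIdxAux_succ']
    unfold ptsIdxAux at hz ⊢
    cases hs : M.step x as with
    | inr b => exact ⟨rfl, rfl⟩
    | inl q =>
      rw [hs] at hz
      simp only [List.mem_cons, not_or] at hz
      have h1 : O as.length q = O' as.length q := hO _ _ (Ne.symm hz.1)
      dsimp only
      rw [← h1]
      obtain ⟨h2, h3⟩ := runIdxAux_congr_of_points M O O' pt z x hO k _ hz.2
      exact ⟨h2, by rw [h3]⟩

end OracleAlg

end Literature.Computability.Complexity

namespace Literature.Computability.Learning

open _root_.Computability Complexity Complexity.OracleAlg Cryptography Polynomial Finset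

open scoped Classical

namespace LearnerDistinguisher

/-! ### The verdict on a parsed coin string -/

section Semantic

variable (A : OracleAlg (List Bool)) (E : OracleAlg Bool) (qA P₁ P₂ : Polynomial ℕ) (n : ℕ)

/-- The number of guess bits `a = L₁ + L₂`. [folklore] -/
def guessBits : ℕ := guessLen P₁ n + guessLen P₂ n

/-- The coin guess read off the guess bits `u`. [folklore] -/
def mOf (u : List Bool) : ℕ := min (bitsToNat (u.take (guessLen P₁ n))) (rulerLen P₁ n)

/-- The evaluation guess read off the guess bits `u`. [folklore] -/
def T₂Of (u : List Bool) : ℕ := min (bitsToNat ((u.drop (guessLen P₁ n)).take (guessLen P₂ n))) (rulerLen P₂ n)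

/-- The learner's input from the guess bits `u` and the coins `v = ρ S'` after the test blocks. [folklore] -/
def xAOf (u v : List Bool) : List Bool :=
  boolPair (pacParams n 8 8) ((v.drop (rulerLen P₁ n - mOf P₁ n u)).take (mOf P₁ n u))

/-- The indexed oracle of the learner on the samples `s = S'`: membership queries by the first bit of `𝒪`,
the `j`-th other query by the labelled example on block `j` of `s`. [Kearns–Vazirani 1994, §1.2, §8.1] [folklore] -/
def baseOracle (𝒪 : Oracle) (n : ℕ) (s : List Bool) : ℕ → List Bool → List Bool := fun j q => fMid 𝒪 (dMath n s j q)

/-- The point of `{0,1}ⁿ` a query touches: `y` for a membership query `1y`, block `j` otherwise. [folklore] -/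
def pointOf (n : ℕ) (s : List Bool) (j : ℕ) (q : List Bool) : List Bool := if isMQ n q then q.tail else block n s j

/-- The learner's output from `(u, v)`. [folklore] -/
def WOf (𝒪 : Oracle) (u v : List Bool) : List Bool :=
  (A.runIdx (baseOracle 𝒪 n (v.drop (rulerLen P₁ n))) (qA.eval (xAOf P₁ n u v).length) (xAOf P₁ n u v)).getD []

/-- The points touched by the learner's run from `(u, v)`. [folklore] -/
def ptsOf (𝒪 : Oracle) (u v : List Bool) : List (List Bool) :=
  A.ptsIdxAux (baseOracle 𝒪 n (v.drop (rulerLen P₁ n))) (pointOf n (v.drop (rulerLen P₁ n))) (xAOf P₁ n u v)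
    (qA.eval (xAOf P₁ n u v).length) []

/-- The first answer bit of the oracle as a Boolean function on strings. [folklore] -/
def headFn (𝒪 : Oracle) (z : List Bool) : Bool := (𝒪 z).headD false

/-- The prediction of the adversary's hypothesis at `z`. [folklore] -/
def pbit (𝒪 : Oracle) (u v z : List Bool) : Bool := predBit E (T₂Of P₁ P₂ n u) (WOf A qA P₁ n 𝒪 u v) z

/-- **The verdict on a parsed coin string** `r = u zz v`: agreement of hypothesis and oracle at `z₀ = zz ↾ n`
iff at `z₁ = zz ⇂ n`. [folklore] -/
def Vsem (𝒪 : Oracle) (u zz v : List Bool) : Bool :=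
  (pbit A E qA P₁ P₂ n 𝒪 u v (zz.take n) == headFn 𝒪 (zz.take n)) ==
    (pbit A E qA P₁ P₂ n 𝒪 u v (zz.drop n) == headFn 𝒪 (zz.drop n))

variable {n} {u zz v : List Bool}

/-- Parsing `r = u zz v`: the layout functions of `CryptoHardnessMachine.lean`. [folklore] -/
theorem parse_append (hu : u.length = guessBits P₁ P₂ n) (r : List Bool) (hr : r = u ++ zz ++ v) :
    g₁ P₁ n r = u.take (guessLen P₁ n) ∧ g₂ P₁ P₂ n r = (u.drop (guessLen P₁ n)).take (guessLen P₂ n) ∧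
      rest₂ P₁ P₂ n r = zz ++ v := by
  subst hr
  have h1 : guessLen P₁ n ≤ u.length := by rw [hu, guessBits]; omega
  have h2 : (u.drop (guessLen P₁ n)).length = guessLen P₂ n := by rw [List.length_drop, hu, guessBits]; omega
  refine ⟨?_, ?_, ?_⟩
  · rw [g₁, List.append_assoc, List.take_append_of_le_length h1]
  · rw [g₂, rest₁, List.append_assoc, List.drop_append_of_le_length h1, List.take_append_of_le_length h2.ge]
  · rw [rest₂, rest₁, List.append_assoc, List.drop_append_of_le_length h1, List.drop_append_of_le_length h2.ge,
      List.drop_eq_nil_of_le h2.le, List.nil_append]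

/-- The coin guess of `u zz v` is `mOf u`. [folklore] -/
theorem coinGuess_append (hu : u.length = guessBits P₁ P₂ n) : coinGuess P₁ n (u ++ zz ++ v) = mOf P₁ n u := by
  rw [coinGuess, (parse_append P₁ P₂ hu _ rfl).1, mOf]

/-- The evaluation guess of `u zz v` is `T₂Of u`. [folklore] -/
theorem evalGuess_append (hu : u.length = guessBits P₁ P₂ n) : evalGuess P₁ P₂ n (u ++ zz ++ v) = T₂Of P₁ P₂ n u := by
  rw [evalGuess, (parse_append P₁ P₂ hu _ rfl).2.1, T₂Of]

/-- The learner's input of `u zz v` is `xAOf u v`. [folklore] -/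
theorem learnerInput_append (hu : u.length = guessBits P₁ P₂ n) (hzz : zz.length = 2 * n) :
    learnerInput P₁ P₂ n (u ++ zz ++ v) = xAOf P₁ n u v := by
  rw [learnerInput, learnerCoins, afterTest, (parse_append P₁ P₂ hu _ rfl).2.2, List.drop_append_of_le_length hzz.ge,
    List.drop_eq_nil_of_le hzz.le, List.nil_append, coinGuess_append P₁ P₂ hu, xAOf]

/-- The samples of `u zz v` are `zz (v ⇂ R₁)`. [folklore] -/
theorem samples_append (hu : u.length = guessBits P₁ P₂ n) (hzz : zz.length = 2 * n) :
    samples P₁ P₂ n (u ++ zz ++ v) = zz ++ v.drop (rulerLen P₁ n) := by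
  rw [samples, testBits, samplesTail, afterTest, (parse_append P₁ P₂ hu _ rfl).2.2, List.take_append_of_le_length hzz.ge,
    List.take_of_length_le hzz.le, List.drop_append_of_le_length hzz.ge, List.drop_eq_nil_of_le hzz.le, List.nil_append]

/-- Block `j + 2` of `zz s` (`|zz| = 2n`) is block `j` of `s`. [folklore] -/
theorem block_append_add_two (hzz : zz.length = 2 * n) (s : List Bool) (j : ℕ) : block n (zz ++ s) (j + 2) = block n s j := by
  rw [block, block, List.drop_append, List.drop_eq_nil_of_le (by rw [hzz]; nlinarith), List.nil_append, hzz,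
    show (j + 2) * n - 2 * n = j * n by rw [add_mul]; omega]

/-- Block `0` of `zz s` is `zz ↾ n`. [folklore] -/
theorem block_append_zero (hzz : zz.length = 2 * n) (s : List Bool) : block n (zz ++ s) 0 = zz.take n := by
  rw [block, Nat.zero_mul, List.drop_zero, List.take_append_of_le_length (by omega)]

/-- Block `1` of `zz s` is `zz ⇂ n`. [folklore] -/
theorem block_append_one (hzz : zz.length = 2 * n) (s : List Bool) : block n (zz ++ s) 1 = zz.drop n := by
  rw [block, Nat.one_mul, List.drop_append_of_le_length (by omega), List.take_append_of_le_length (by simp; omega),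
    List.take_of_length_le (by simp; omega)]

/-- The learner's oracle on `zz s` is the base oracle on `s`. [folklore] -/
theorem learnOracle_append (hzz : zz.length = 2 * n) (𝒪 : Oracle) (s : List Bool) :
    learnOracle 𝒪 n (zz ++ s) = baseOracle 𝒪 n s := by
  funext j q
  simp only [learnOracle, baseOracle, dMath, block_append_add_two hzz]

/-- The learner's output of `u zz v` is `WOf u v`. [folklore] -/
theorem learnOut_append (hu : u.length = guessBits P₁ P₂ n) (hzz : zz.length = 2 * n) (𝒪 : Oracle) :
    learnOut A qA 𝒪 n (learnerInput P₁ P₂ n (u ++ zz ++ v)) (samples P₁ P₂ n (u ++ zz ++ v)) = WOf A qA P₁ n 𝒪 u v := by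
  rw [learnOut, learnerInput_append P₁ P₂ hu hzz, samples_append P₁ P₂ hu hzz, learnOracle_append hzz, WOf]

/-- `(l ↾ 1).headD d = l.headD d` (twin of `Cryptography.GLHardCore.headD_take_one`,
`CryptoFoundationsOneWayFunctionsS24Proofs.lean`, outside this file's import cone). [folklore] -/
theorem headD_take_one (l : List Bool) (d : Bool) : (l.take 1).headD d = l.headD d := by
  cases l <;> rfl

/-- The agreement bit on a genuine labelled example `z · 𝒪(z)₀`. [folklore] -/
theorem agreeBit_example (T : ℕ) (w z : List Bool) (hz : z.length = n) (𝒪 : Oracle) :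
    agreeBit E T n w (z ++ (𝒪 z).take 1) = (predBit E T w z == headFn 𝒪 z) := by
  rw [agreeBit, List.take_append_of_le_length hz.ge, List.take_of_length_le hz.le, List.drop_append_of_le_length hz.ge,
    List.drop_eq_nil_of_le hz.le, List.nil_append, headD_take_one, headFn]

/-- **The verdict of the distinguisher on a parsed coin string.** [folklore] -/
theorem verdict_append (hu : u.length = guessBits P₁ P₂ n) (hzz : zz.length = 2 * n) (𝒪 : Oracle) :
    verdict A E qA P₁ P₂ n (u ++ zz ++ v) 𝒪 = Vsem A E qA P₁ P₂ n 𝒪 u zz v := by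
  have hz0 : (zz.take n).length = n := by simp; omega
  have hz1 : (zz.drop n).length = n := by simp; omega
  rw [verdict, verdictOf, learnOut_append A qA P₁ P₂ hu hzz, evalGuess_append P₁ P₂ hu, samples_append P₁ P₂ hu hzz,
    exampleAns, exampleAns, block_append_zero hzz, block_append_one hzz, agreeBit_example E _ _ _ hz0,
    agreeBit_example E _ _ _ hz1, Vsem, pbit, pbit]

end Semantic

/-! ### The real game: a PAC-learnable first answer bit -/

section RealGame

variable (A : OracleAlg (List Bool)) (E : OracleAlg Bool) (qA P₁ P₂ : Polynomial ℕ) (n : ℕ) (𝒪 : Oracle)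

/-- The number of points where the hypothesis `evalHyp E T w` disagrees with the first answer bit of `𝒪`. [folklore] -/
def disagreeCount (T : ℕ) (w : List Bool) : ℕ :=
  (univ.filter fun x : Fin n → Bool => predBit E T w (List.ofFn x) ≠ headFn 𝒪 (List.ofFn x)).card

/-- The number of points where it agrees. [folklore] -/
def agreeCount (T : ℕ) (w : List Bool) : ℕ :=
  (univ.filter fun x : Fin n → Bool => predBit E T w (List.ofFn x) = headFn 𝒪 (List.ofFn x)).card

/-- Agreements and disagreements partition `{0,1}ⁿ`. [folklore] -/
theorem agreeCount_add_disagreeCount (T : ℕ) (w : List Bool) :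
    agreeCount E n 𝒪 T w + disagreeCount E n 𝒪 T w = 2 ^ n := by
  rw [agreeCount, disagreeCount, Finset.card_filter_add_card_filter_not, card_univ, card_fun_fin_bool]

variable {n}

/-- **Counting the verdict over the two test blocks**: `#{z₀ z₁ | verdict} = (#agree)² + (#disagree)²`.
[GGM 1986, §3; Kearns–Valiant 1994, §3] [folklore] -/
theorem card_Vsem (u v : List Bool) :
    (univ.filter fun h : Fin (n + n) → Bool => Vsem A E qA P₁ P₂ n 𝒪 u (List.ofFn h) v = true).card =
      agreeCount E n 𝒪 (T₂Of P₁ P₂ n u) (WOf A qA P₁ n 𝒪 u v) ^ 2 +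
        disagreeCount E n 𝒪 (T₂Of P₁ P₂ n u) (WOf A qA P₁ n 𝒪 u v) ^ 2 := by
  set agree : (Fin n → Bool) → Bool :=
    fun x => (pbit A E qA P₁ P₂ n 𝒪 u v (List.ofFn x) == headFn 𝒪 (List.ofFn x)) with hagree
  -- over pairs of blocks
  have h1 : (univ.filter fun h : Fin (n + n) → Bool => Vsem A E qA P₁ P₂ n 𝒪 u (List.ofFn h) v = true).card =
      (univ.filter fun p : (Fin n → Bool) × (Fin n → Bool) => (agree p.1 == agree p.2) = true).card := by
    symm
    refine card_equiv (Fin.appendEquiv n n) fun p => ?_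
    obtain ⟨x₀, x₁⟩ := p
    have hsplit : List.ofFn (Fin.appendEquiv n n (x₀, x₁)) = List.ofFn x₀ ++ List.ofFn x₁ := by
      simp [Fin.appendEquiv, List.ofFn_fin_append]
    have hx : (List.ofFn x₀).length = n := List.length_ofFn
    simp only [mem_filter, mem_univ, true_and, hsplit, Vsem, List.take_left' hx, List.drop_left' hx, hagree]
  -- fibrewise over the second block
  have h2 : (univ.filter fun p : (Fin n → Bool) × (Fin n → Bool) => (agree p.1 == agree p.2) = true).card =
      ∑ x₁ : Fin n → Bool, (univ.filter fun x₀ : Fin n → Bool => (agree x₀ == agree x₁) = true).card := by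
    rw [card_eq_sum_card_fiberwise (f := Prod.snd) (t := univ) (fun _ _ => mem_univ _)]
    refine sum_congr rfl fun x₁ _ => ?_
    have hinj : Function.Injective (fun x₀ : Fin n → Bool => (x₀, x₁)) := fun a b h => by simpa using h
    rw [← card_image_of_injective (univ.filter fun x₀ : Fin n → Bool => (agree x₀ == agree x₁) = true) hinj]
    congr 1
    refine Finset.ext fun p => ?_
    obtain ⟨a, b⟩ := p
    simp only [mem_filter, mem_univ, true_and, mem_image, Prod.mk.injEq]
    constructor
    · rintro ⟨h, rfl⟩; exact ⟨a, h, rfl, rfl⟩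
    · rintro ⟨a', h, rfl, rfl⟩; exact ⟨h, rfl⟩
  have hA : agreeCount E n 𝒪 (T₂Of P₁ P₂ n u) (WOf A qA P₁ n 𝒪 u v) = (univ.filter fun x : Fin n → Bool => agree x = true).card := by
    rw [agreeCount]; congr 1; refine filter_congr fun x _ => ?_; simp [hagree, pbit]
  have hD : disagreeCount E n 𝒪 (T₂Of P₁ P₂ n u) (WOf A qA P₁ n 𝒪 u v) = (univ.filter fun x : Fin n → Bool => agree x = false).card := by
    rw [disagreeCount]; congr 1; refine filter_congr fun x _ => ?_; simp [hagree, pbit]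
  rw [h1, h2, hA, hD, ← sum_filter_add_sum_filter_not univ (fun x₁ : Fin n → Bool => agree x₁ = true)]
  have e1 : ∀ x₁ ∈ univ.filter (fun x₁ : Fin n → Bool => agree x₁ = true),
      (univ.filter fun x₀ : Fin n → Bool => (agree x₀ == agree x₁) = true).card =
        (univ.filter fun x : Fin n → Bool => agree x = true).card := by
    intro x₁ hx₁
    rw [mem_filter] at hx₁
    congr 1; refine filter_congr fun x _ => ?_; rw [hx₁.2]; simp
  have e2 : ∀ x₁ ∈ univ.filter (fun x₁ : Fin n → Bool => ¬agree x₁ = true),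
      (univ.filter fun x₀ : Fin n → Bool => (agree x₀ == agree x₁) = true).card =
        (univ.filter fun x : Fin n → Bool => agree x = false).card := by
    intro x₁ hx₁
    rw [mem_filter, Bool.not_eq_true] at hx₁
    congr 1; refine filter_congr fun x _ => ?_; rw [hx₁.2]; simp
  rw [sum_congr rfl e1, sum_congr rfl e2, sum_const, sum_const, smul_eq_mul, smul_eq_mul]
  have hneg : (univ.filter fun x₁ : Fin n → Bool => ¬agree x₁ = true) = univ.filter fun x : Fin n → Bool => agree x = false :=
    filter_congr fun x _ => by simp
  rw [hneg]
  ring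

/-- `Pr_{zz}[verdict] = ((#agree)² + (#disagree)²) / 4ⁿ`. [folklore] -/
theorem uniformProb_Vsem_eq (u v : List Bool) :
    uniformProb (n + n) {zz | Vsem A E qA P₁ P₂ n 𝒪 u zz v = true} =
      ((agreeCount E n 𝒪 (T₂Of P₁ P₂ n u) (WOf A qA P₁ n 𝒪 u v) : ℝ) ^ 2 +
        (disagreeCount E n 𝒪 (T₂Of P₁ P₂ n u) (WOf A qA P₁ n 𝒪 u v) : ℝ) ^ 2) / ((2 : ℝ) ^ n) ^ 2 := by
  rw [uniformProb_eq_card_fun]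
  have h := card_Vsem A E qA P₁ P₂ 𝒪 u v (n := n)
  simp only [Set.mem_setOf_eq] at h ⊢
  rw [h, pow_add]
  push_cast
  ring

/-- **The two-sided test accepts with probability `≥ 1/2`, whatever the hypothesis.** [folklore] -/
theorem half_le_uniformProb_Vsem (u v : List Bool) :
    1 / 2 ≤ uniformProb (n + n) {zz | Vsem A E qA P₁ P₂ n 𝒪 u zz v = true} := by
  rw [uniformProb_Vsem_eq]
  have hsum := agreeCount_add_disagreeCount E n 𝒪 (T₂Of P₁ P₂ n u) (WOf A qA P₁ n 𝒪 u v)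
  set a := (agreeCount E n 𝒪 (T₂Of P₁ P₂ n u) (WOf A qA P₁ n 𝒪 u v) : ℝ) with ha
  set b := (disagreeCount E n 𝒪 (T₂Of P₁ P₂ n u) (WOf A qA P₁ n 𝒪 u v) : ℝ) with hb
  have hN : a + b = (2 : ℝ) ^ n := by rw [ha, hb]; exact_mod_cast hsum
  rw [le_div_iff₀ (by positivity), ← hN]
  nlinarith [sq_nonneg (a - b)]

/-- **… and with probability `≥ 3/4` when the hypothesis errs on at most `1/8` of the points.** [folklore] -/
theorem uniformProb_Vsem_ge_of_disagree (u v : List Bool)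
    (h : 8 * disagreeCount E n 𝒪 (T₂Of P₁ P₂ n u) (WOf A qA P₁ n 𝒪 u v) ≤ 2 ^ n) :
    1 / 2 + 1 / 4 ≤ uniformProb (n + n) {zz | Vsem A E qA P₁ P₂ n 𝒪 u zz v = true} := by
  rw [uniformProb_Vsem_eq]
  have hsum := agreeCount_add_disagreeCount E n 𝒪 (T₂Of P₁ P₂ n u) (WOf A qA P₁ n 𝒪 u v)
  set a := (agreeCount E n 𝒪 (T₂Of P₁ P₂ n u) (WOf A qA P₁ n 𝒪 u v) : ℝ) with ha
  set b := (disagreeCount E n 𝒪 (T₂Of P₁ P₂ n u) (WOf A qA P₁ n 𝒪 u v) : ℝ) with hb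
  have hN : a + b = (2 : ℝ) ^ n := by rw [ha, hb]; exact_mod_cast hsum
  have h8 : 8 * b ≤ (2 : ℝ) ^ n := by rw [hb]; exact_mod_cast h
  have hb0 : 0 ≤ b := by rw [hb]; positivity
  rw [le_div_iff₀ (by positivity), ← hN]
  nlinarith [sq_nonneg (a - b)]

/-- Restricting an inclusion to strings of the right length. [folklore] -/
theorem uniformProb_mono_len (m : ℕ) {S F : Set (List Bool)} (h : ∀ r : List Bool, r.length = m → r ∈ S → r ∈ F) :
    uniformProb m S ≤ uniformProb m F := by
  rw [uniformProb_congr_len m (F := S ∩ {r | r.length = m}) (fun r hr => by simp [hr])]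
  exact uniformProb_mono' m fun r hr => h r hr.2 hr.1

/-- **A fixed prefix and an event of the suffix**: `Pr[u = u₀ ∧ G(w)] = Pr[G] / 2^{|u₀|}`, hence
`Pr_r[G (r ↾ a) (r ⇂ (a+ℓ))] ≥ Pr_w[G u₀ w] / 2^a` for any `u₀` of length `a`. [Arora–Barak 2009, §A.2] [folklore] -/
theorem uniformProb_suffix_div_le {a ℓ d : ℕ} (G : List Bool → List Bool → Prop) (u₀ : List Bool) (hu₀ : u₀.length = a) :
    uniformProb d {w | G u₀ w} / 2 ^ a ≤ uniformProb (a + ℓ + d) {r | G (r.take a) (r.drop (a + ℓ))} := by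
  refine le_trans (le_of_eq ?_)
    (uniformProb_mono' _ (E := {r | r.take a = u₀ ∧ G u₀ (r.drop (a + ℓ))}) fun r hr => by
      obtain ⟨h1, h2⟩ := hr; simp only [Set.mem_setOf_eq]; rwa [h1])
  rw [uniformProb_outside_eq (good := fun u w => u = u₀ ∧ G u₀ w), uniformProb_eq_card_fun, pow_add, div_div,
    mul_comm ((2 : ℝ) ^ a)]
  congr 2
  subst hu₀
  set uf₀ : Fin u₀.length → Bool := fun i => u₀[(i : ℕ)] with huf₀
  have huf₀' : List.ofFn uf₀ = u₀ := by rw [huf₀, List.ofFn_getElem]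
  refine card_nbij' (fun wf => (uf₀, wf)) (fun uw => uw.2) ?_ ?_ ?_ ?_
  · intro wf hwf
    simp only [mem_coe, mem_filter, mem_univ, true_and, Set.mem_setOf_eq] at hwf ⊢
    exact ⟨huf₀', hwf⟩
  · intro uw huw
    simp only [mem_coe, mem_filter, mem_univ, true_and, Set.mem_setOf_eq] at huw ⊢
    exact huw.2
  · intro wf _; rfl
  · intro uw huw
    simp only [mem_coe, mem_filter, mem_univ, true_and] at huw
    obtain ⟨u1, u2⟩ := uw
    simp only [Prod.mk.injEq, and_true]
    exact List.ofFn_injective (huf₀'.trans huw.1.symm)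

/-- **Averaging over the test blocks**: the acceptance probability is at least `1/2` plus a quarter of the
probability that the guesses and the learner produce a hypothesis erring on `≤ 1/8` of the points.
[GGM 1986, §3; Kearns–Valiant 1994, §3] [folklore] -/
theorem uniformProb_verdict_ge (d : ℕ) :
    1 / 2 + 1 / 4 * uniformProb (guessBits P₁ P₂ n + 2 * n + d)
        {r | 8 * disagreeCount E n 𝒪 (T₂Of P₁ P₂ n (r.take (guessBits P₁ P₂ n)))
          (WOf A qA P₁ n 𝒪 (r.take (guessBits P₁ P₂ n)) (r.drop (guessBits P₁ P₂ n + 2 * n))) ≤ 2 ^ n} ≤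
      uniformProb (guessBits P₁ P₂ n + 2 * n + d) {r | verdict A E qA P₁ P₂ n r 𝒪 = true} := by
  set a := guessBits P₁ P₂ n with ha
  have hwin : uniformProb (a + 2 * n + d) {r | verdict A E qA P₁ P₂ n r 𝒪 = true} =
      uniformProb (a + 2 * n + d) {r | (r.drop a).take (2 * n) ∈
        {zz | Vsem A E qA P₁ P₂ n 𝒪 (r.take a) zz (r.drop (a + 2 * n)) = true}} := by
    refine uniformProb_congr_len _ fun r hr => ?_
    simp only [Set.mem_setOf_eq]
    have hsplit : r = r.take a ++ (r.drop a).take (2 * n) ++ r.drop (a + 2 * n) := by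
      rw [List.append_assoc, ← List.drop_drop, List.take_append_drop, List.take_append_drop]
    conv_lhs => rw [hsplit]
    rw [verdict_append A E qA P₁ P₂ (by simp; omega) (by simp; omega)]
  rw [hwin, two_mul]
  exact le_uniformProb_window (fun u v => {zz | Vsem A E qA P₁ P₂ n 𝒪 u zz v = true})
    (fun u v => 8 * disagreeCount E n 𝒪 (T₂Of P₁ P₂ n u) (WOf A qA P₁ n 𝒪 u v) ≤ 2 ^ n)
    (fun u v _ _ => half_le_uniformProb_Vsem A E qA P₁ P₂ 𝒪 u v)
    (fun u v _ _ hg => uniformProb_Vsem_ge_of_disagree A E qA P₁ P₂ 𝒪 u v hg)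

/-! #### The right guess: the learner sees `pacOracle` on uniform examples -/

variable {T₂star Tstar cstar : ℕ} {f : (Fin n → Bool) → Bool}

/-- The error of a hypothesis under the uniform distribution is the fraction of disagreements. [folklore] -/
theorem errorProb_uniform_eq (h g : (Fin n → Bool) → Bool) :
    errorProb (PMF.uniformOfFintype (Fin n → Bool)) h g =
      ((univ.filter fun x : Fin n → Bool => h x ≠ g x).card : ENNReal) / 2 ^ n := by
  rw [errorProb, PMF.toOuterMeasure_uniformOfFintype_apply, card_fun_fin_bool, Fintype.card_ofFinset]
  push_cast
  congr 2

/-- `error ≤ 1/8` under the uniform distribution means `8 · #disagreements ≤ 2ⁿ`. [folklore] -/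
theorem eight_mul_card_le_of_errorProb_le (h g : (Fin n → Bool) → Bool)
    (herr : errorProb (PMF.uniformOfFintype (Fin n → Bool)) h g ≤ ENNReal.ofReal (1 / 8)) :
    8 * (univ.filter fun x : Fin n → Bool => h x ≠ g x).card ≤ 2 ^ n := by
  rw [errorProb_uniform_eq, ENNReal.div_le_iff (by positivity) (by simp), one_div,
    ENNReal.ofReal_inv_of_pos (by norm_num), ENNReal.ofReal_ofNat] at herr
  have h8 : (8 : ENNReal) * (((univ.filter fun x : Fin n → Bool => h x ≠ g x).card : ENNReal)) ≤ 8 * (8⁻¹ * 2 ^ n) := by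
    gcongr
  rw [← mul_assoc, ENNReal.mul_inv_cancel (by norm_num) (by simp), one_mul] at h8
  exact_mod_cast h8

/-- `evalHyp` is `predBit` on the encoded point (definitional). [folklore] -/
theorem evalHyp_eq_predBit (T : ℕ) (w : List Bool) (x : Fin n → Bool) : evalHyp E T w x = predBit E T w (List.ofFn x) := rfl

/-- The `j`-th point read off the samples. [folklore] -/
theorem getElem?_pointsOf (T : ℕ) (s : List Bool) {j : ℕ} (hj : j < T) :
    (pointsOf n T s)[j]? = some fun e : Fin n => s.getD (j * n + e) false := by
  rw [pointsOf, List.getElem?_ofFn]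
  simp [hj]

/-- `pacOracle true` on a query that is not a membership query returns the example, as `pacOracle false`
does. [Kearns–Vazirani 1994, §1.2] [folklore] -/
theorem pacOracle_true_of_isMQ_false (g : (Fin n → Bool) → Bool) (xs : List (Fin n → Bool)) (j : ℕ) {q : List Bool}
    (hq : isMQ n q = false) : pacOracle true g xs j q = pacOracle false g xs j q := by
  cases q with
  | nil => rfl
  | cons b t =>
    cases b with
    | false => rfl
    | true =>
      have ht : t.length ≠ n := by simpa [isMQ] using hq
      have hdec : (encodingBitVec n).decode t = none := by simp [encodingBitVec, ht]
      simp only [pacOracle, hdec]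

/-- A nonempty answer's first bit. [folklore] -/
theorem take_one_eq_headD {l : List Bool} (h : l ≠ []) : l.take 1 = [l.headD false] := by
  cases l with
  | nil => exact absurd rfl h
  | cons b t => rfl

/-- **The learner's simulated oracle is `pacOracle true f xs`** at every index `j < T` (all `T` example
blocks lying within the samples `s`), when `f` is the first answer bit of `𝒪` and `𝒪` answers `n`-bit
queries nonemptily. [Kearns–Vazirani 1994, §1.2, §8.1] [folklore] -/
theorem baseOracle_eq_pacOracle (hf : ∀ x : Fin n → Bool, f x = headFn 𝒪 (List.ofFn x))
    (h𝒪 : ∀ y : List Bool, y.length = n → 𝒪 y ≠ []) (s : List Bool) {T : ℕ} (hs : T * n ≤ s.length) {j : ℕ}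
    (hj : j < T) (q : List Bool) : baseOracle 𝒪 n s j q = pacOracle true f (pointsOf n T s) j q := by
  unfold baseOracle fMid dMath
  cases hq : isMQ n q
  · -- an example request
    rw [if_neg Bool.false_ne_true, pacOracle_true_of_isMQ_false f _ j hq, pacOracle_false, getElem?_pointsOf T s hj]
    have hjn : j * n + n ≤ s.length := le_trans (by nlinarith) hs
    have hblk : (List.ofFn fun e : Fin n => s.getD (j * n + e) false) = block n s j := ofFn_getD_eq_take_drop n s _ hjn
    have hlen : (block n s j).length = n := by rw [← hblk, List.length_ofFn]
    simp only [encodeExample, List.headD_cons, List.tail_cons, hblk, hf, headFn, take_one_eq_headD (h𝒪 _ hlen),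
      Bool.false_eq_true, if_false]
  · -- a membership query `1y`, `|y| = n`
    obtain ⟨b, y, rfl⟩ : ∃ b y, q = b :: y := by
      cases q with
      | nil => simp [isMQ] at hq
      | cons b y => exact ⟨b, y, rfl⟩
    simp only [isMQ, List.headD_cons, List.tail_cons, Bool.and_eq_true, decide_eq_true_eq] at hq
    obtain ⟨rfl, hy⟩ := hq
    set x : Fin n → Bool := fun i => y[(i : ℕ)]'(by omega) with hx
    have hyx : y = List.ofFn x := by
      apply List.ext_getElem (by simp [hy])
      intro i h1 h2; simp [hx]
    rw [if_pos rfl, hyx, pacOracle_true_query, hf, headFn, take_one_eq_headD (h𝒪 _ (by simp))]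
    rfl

/-- **Given the right guesses and a successful PAC run, the adversary's learner outputs the PAC hypothesis.**
On coins `v` (after the test blocks) whose window `rc · (T* example blocks)` is a success of the PAC game
(`PACUniformCoins.pacWindow`), `WOf u₀ v` is the output of that PAC run. [Kearns–Valiant 1994, §3] [folklore] -/
theorem learnOut_eq_of_pacSuccess (hf : ∀ x : Fin n → Bool, f x = headFn 𝒪 (List.ofFn x))
    (h𝒪 : ∀ y : List Bool, y.length = n → 𝒪 y ≠ []) {u₀ : List Bool} (hm : mOf P₁ n u₀ = cstar)
    (hT : Tstar ≤ qA.eval (4 * n + 58 + cstar)) (hcR : cstar ≤ rulerLen P₁ n) {v : List Bool}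
    (hv : rulerLen P₁ n + Tstar * n ≤ v.length) {w₀ : List Bool}
    (hrun : A.runIdx (pacOracle true f (pointsOf n Tstar (v.drop (rulerLen P₁ n)))) Tstar
      (boolPair (pacParams n 8 8) ((v.drop (rulerLen P₁ n - cstar)).take cstar)) = some w₀) :
    WOf A qA P₁ n 𝒪 u₀ v = w₀ := by
  have hxA : xAOf P₁ n u₀ v = boolPair (pacParams n 8 8) ((v.drop (rulerLen P₁ n - cstar)).take cstar) := by
    rw [xAOf, hm]
  have hlen : (xAOf P₁ n u₀ v).length = 4 * n + 58 + cstar := by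
    rw [hxA, length_boolPair, pacParams, length_boolPair, length_boolPair, length_unaryEncodeNat, length_unaryEncodeNat,
      List.length_take, List.length_drop, min_eq_left (by omega)]
    omega
  have hs : Tstar * n ≤ (v.drop (rulerLen P₁ n)).length := by rw [List.length_drop]; omega
  have hagree : A.runIdx (baseOracle 𝒪 n (v.drop (rulerLen P₁ n))) Tstar (xAOf P₁ n u₀ v) = some w₀ := by
    rw [hxA, OracleAlg.runIdx, runIdxAux_congr_lt A _ (pacOracle true f (pointsOf n Tstar (v.drop (rulerLen P₁ n)))) _ Tstar []
      (fun j hj q => baseOracle_eq_pacOracle 𝒪 hf h𝒪 _ hs (by simpa using hj) q)]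
    exact hrun
  rw [WOf, OracleAlg.runIdx, runIdxAux_mono A _ _ (by rw [hlen]; exact hT) hagree]
  rfl

/-- **With the right guesses, the hypothesis is good with probability `≥ 7/8`** over the coins after the
test blocks: the PAC guarantee (`pacSuccessProb ≥ 7/8` at accuracy and confidence `1/8`), transported by
`pacSuccessProb_uniform_eq_uniformProb` and the window formula. [Kearns–Valiant 1994, §3; Valiant 1984, §2] [folklore] -/
theorem uniformProb_good_ge (hf : ∀ x : Fin n → Bool, f x = headFn 𝒪 (List.ofFn x))
    (h𝒪 : ∀ y : List Bool, y.length = n → 𝒪 y ≠ []) {u₀ : List Bool} (hm : mOf P₁ n u₀ = cstar) (hT₂ : T₂Of P₁ P₂ n u₀ = T₂star)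
    (hT : Tstar ≤ qA.eval (4 * n + 58 + cstar)) (hcR : cstar ≤ rulerLen P₁ n) {d : ℕ} (hd : rulerLen P₁ n + Tstar * n ≤ d)
    (hPAC : ENNReal.ofReal (7 / 8) ≤ pacSuccessProb (fun w => evalHyp E T₂star w) true A (pacParams n 8 8) Tstar cstar f
      (PMF.uniformOfFintype _) (1 / 8)) :
    7 / 8 ≤ uniformProb d {v | 8 * disagreeCount E n 𝒪 (T₂Of P₁ P₂ n u₀) (WOf A qA P₁ n 𝒪 u₀ v) ≤ 2 ^ n} := by
  obtain ⟨d', rfl⟩ : ∃ d', d = (rulerLen P₁ n - cstar) + (cstar + Tstar * n) + d' :=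
    ⟨d - (rulerLen P₁ n + Tstar * n), by omega⟩
  have hp1 : pacSuccessProb (fun w => evalHyp E T₂star w) true A (pacParams n 8 8) Tstar cstar f
      (PMF.uniformOfFintype _) (1 / 8) ≤ 1 := by
    rw [pacSuccessProb, PMF.toOuterMeasure_apply_singleton]; exact PMF.coe_le_one _ _
  have h78 : (7 / 8 : ℝ) ≤ uniformProb (cstar + Tstar * n)
      (pacWindow (fun w => evalHyp E T₂star w) true A (pacParams n 8 8) Tstar cstar f (1 / 8)) := by
    rw [← pacSuccessProb_uniform_eq_uniformProb]
    exact (ENNReal.ofReal_le_iff_le_toReal (ne_top_of_le_ne_top ENNReal.one_ne_top hp1)).1 hPAC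
  refine h78.trans ?_
  rw [← uniformProb_window_const (a := rulerLen P₁ n - cstar) (d := d')]
  refine uniformProb_mono_len _ fun v hv hwin => ?_
  simp only [Set.mem_setOf_eq, pacWindow, pacSuccess] at hwin ⊢
  have hcw : ((v.drop (rulerLen P₁ n - cstar)).take (cstar + Tstar * n)).take cstar = (v.drop (rulerLen P₁ n - cstar)).take cstar := by
    rw [List.take_take, min_eq_left (by omega)]
  have hsw : ((v.drop (rulerLen P₁ n - cstar)).take (cstar + Tstar * n)).drop cstar = (v.drop (rulerLen P₁ n)).take (Tstar * n) := by
    rw [List.drop_take, List.drop_drop, Nat.add_sub_cancel_left, show rulerLen P₁ n - cstar + cstar = rulerLen P₁ n by omega]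
  rw [hcw, hsw, pointsOf_take n Tstar _ le_rfl] at hwin
  split at hwin
  · rename_i w₀ hrun
    rw [decide_eq_true_eq] at hwin
    rw [learnOut_eq_of_pacSuccess A qA P₁ 𝒪 hf h𝒪 hm hT hcR (by omega) hrun, hT₂]
    have h := eight_mul_card_le_of_errorProb_le _ _ hwin
    simp only [evalHyp_eq_predBit, hf] at h
    exact h
  · exact absurd hwin Bool.false_ne_true

/-- **The real game.** Against an oracle answering `n`-bit queries nonemptily whose first answer bit `f` the
pair `(A, E)` PAC-learns at accuracy and confidence `1/8` with `c*` coins and `T*`, `T₂*` rounds (guessable: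
`c* < 2^{L₁}`, `T₂* < 2^{L₂}`; within the clock: `T* ≤ qA(4n + 58 + c*)`; within the coins), the distinguisher
accepts with probability `≥ 1/2 + (7/32) · 2^{-(L₁+L₂)}`. [GGM 1986, §3; Kearns–Valiant 1994, §3;
Oliveira–Santhanam 2017, §4 Prop. 1] [folklore] -/
theorem acceptProb_real_ge (hf : ∀ x : Fin n → Bool, f x = headFn 𝒪 (List.ofFn x))
    (h𝒪 : ∀ y : List Bool, y.length = n → 𝒪 y ≠ []) (hc : cstar < 2 ^ guessLen P₁ n) (hT₂ : T₂star < 2 ^ guessLen P₂ n)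
    (hT : Tstar ≤ qA.eval (4 * n + 58 + cstar)) {d : ℕ} (hd : rulerLen P₁ n + Tstar * n ≤ d)
    (hC : (coinsPoly qA P₁ P₂).eval n = guessBits P₁ P₂ n + 2 * n + d)
    (hPAC : ENNReal.ofReal (7 / 8) ≤ pacSuccessProb (fun w => evalHyp E T₂star w) true A (pacParams n 8 8) Tstar cstar f
      (PMF.uniformOfFintype _) (1 / 8)) :
    1 / 2 + 7 / 32 / 2 ^ guessBits P₁ P₂ n ≤ (distinguisher A E qA P₁ P₂).acceptProb 𝒪 n := by
  -- the right guess bits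
  set u₀ := natBits (guessLen P₁ n) cstar ++ natBits (guessLen P₂ n) T₂star with hu₀
  have hu₀len : u₀.length = guessBits P₁ P₂ n := by simp [hu₀, guessBits]
  have hcR : cstar ≤ rulerLen P₁ n := by rw [rulerLen]; have := two_pow_guessLen_le P₁ n; omega
  have hT₂R : T₂star ≤ rulerLen P₂ n := by rw [rulerLen]; have := two_pow_guessLen_le P₂ n; omega
  have hm : mOf P₁ n u₀ = cstar := by
    rw [mOf, hu₀, List.take_append_of_le_length (by simp), List.take_of_length_le (by simp),
      bitsToNat_natBits hc, min_eq_left hcR]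
  have hT₂' : T₂Of P₁ P₂ n u₀ = T₂star := by
    rw [T₂Of, hu₀, List.drop_append_of_le_length (by simp), List.drop_eq_nil_of_le (by simp), List.nil_append,
      List.take_of_length_le (by simp), bitsToNat_natBits hT₂, min_eq_left hT₂R]
  have hgood := uniformProb_good_ge A E qA P₁ P₂ 𝒪 hf h𝒪 hm hT₂' hT hcR hd hPAC
  have havg := uniformProb_verdict_ge A E qA P₁ P₂ 𝒪 d (n := n)
  have hfix := uniformProb_suffix_div_le (ℓ := 2 * n) (d := d)
    (fun u v => 8 * disagreeCount E n 𝒪 (T₂Of P₁ P₂ n u) (WOf A qA P₁ n 𝒪 u v) ≤ 2 ^ n) u₀ hu₀len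
  rw [acceptProb_distinguisher, hC]
  have h2a : (0 : ℝ) < 2 ^ guessBits P₁ P₂ n := by positivity
  calc (1 : ℝ) / 2 + 7 / 32 / 2 ^ guessBits P₁ P₂ n = 1 / 2 + 1 / 4 * (7 / 8 / 2 ^ guessBits P₁ P₂ n) := by ring
    _ ≤ 1 / 2 + 1 / 4 * (uniformProb d {v | 8 * disagreeCount E n 𝒪 (T₂Of P₁ P₂ n u₀) (WOf A qA P₁ n 𝒪 u₀ v) ≤ 2 ^ n} /
          2 ^ guessBits P₁ P₂ n) := by gcongr
    _ ≤ _ := by nlinarith [hfix, havg]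

end RealGame

/-! ### The ideal game: a uniformly random function table -/

section IdealGame

variable (A : OracleAlg (List Bool)) (E : OracleAlg Bool) (qA P₁ P₂ : Polynomial ℕ) {n ℓ : ℕ}

/-- Flipping the first bit of a string. [folklore] -/
def flipHeadList : List Bool → List Bool
  | [] => []
  | b :: t => (!b) :: t

/-- `flipHeadList` preserves the length. [folklore] -/
@[simp] theorem length_flipHeadList : ∀ l : List Bool, (flipHeadList l).length = l.length
  | [] => rfl
  | _ :: _ => rfl

/-- `flipHeadList` is an involution. [folklore] -/
@[simp] theorem flipHeadList_flipHeadList : ∀ l : List Bool, flipHeadList (flipHeadList l) = l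
  | [] => rfl
  | b :: t => by simp [flipHeadList]

/-- The first bit is flipped (on a nonempty string). [folklore] -/
theorem headD_flipHeadList {l : List Bool} (h : l ≠ []) : (flipHeadList l).headD false = !(l.headD false) := by
  cases l with
  | nil => exact absurd rfl h
  | cons b t => rfl

/-- Flipping the first bit of an `ℓ`-bit word. [folklore] -/
def flipHead (w : List.Vector Bool ℓ) : List.Vector Bool ℓ := ⟨flipHeadList w.toList, by simp⟩

/-- `flipHead` is an involution. [folklore] -/
@[simp] theorem flipHead_flipHead (w : List.Vector Bool ℓ) : flipHead (flipHead w) = w := by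
  apply List.Vector.toList_injective; simp [flipHead]

/-- **The flip of a function table at one point**: the involution behind "a fresh value of a random
function is a fair coin". [GGM 1986, §3] [folklore] -/
def flipAt (z : List.Vector Bool n) (H : List.Vector Bool n → List.Vector Bool ℓ) : List.Vector Bool n → List.Vector Bool ℓ :=
  Function.update H z (flipHead (H z))

/-- `flipAt z` is an involution. [folklore] -/
@[simp] theorem flipAt_flipAt (z : List.Vector Bool n) (H : List.Vector Bool n → List.Vector Bool ℓ) :
    flipAt z (flipAt z H) = H := by
  funext y
  unfold flipAt
  by_cases hy : y = z
  · subst hy; simp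
  · simp [Function.update_of_ne hy]

/-- The flipped table's oracle agrees with the original one off the flipped point. [folklore] -/
theorem oracleOfTable_flipAt_of_ne (z : List.Vector Bool n) (H : List.Vector Bool n → List.Vector Bool ℓ) {y : List Bool}
    (hy : y ≠ z.toList) : oracleOfTable (flipAt z H) y = oracleOfTable H y := by
  unfold oracleOfTable flipAt
  split_ifs with h
  · rw [Function.update_of_ne]
    intro heq
    exact hy (by rw [← heq]; rfl)
  · rfl

/-- At the flipped point the first answer bit flips (`ℓ ≥ 1`). [folklore] -/
theorem headFn_oracleOfTable_flipAt_self (hℓ : 1 ≤ ℓ) (z : List.Vector Bool n)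
    (H : List.Vector Bool n → List.Vector Bool ℓ) :
    headFn (oracleOfTable (flipAt z H)) z.toList = !headFn (oracleOfTable H) z.toList := by
  have hne : (H z).toList ≠ [] := by
    intro h; have := congrArg List.length h; simp at this; omega
  simp only [headFn, oracleOfTable_toList, flipAt, Function.update_self, flipHead, List.Vector.toList_mk,
    headD_flipHeadList hne]

/-- A random table answers `n`-bit queries with `ℓ`-bit (nonempty for `ℓ ≥ 1`) words. [folklore] -/
theorem oracleOfTable_ne_nil (hℓ : 1 ≤ ℓ) (H : List.Vector Bool n → List.Vector Bool ℓ) (y : List Bool) (hy : y.length = n) :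
    oracleOfTable H y ≠ [] := by
  intro h
  have := length_oracleOfTable_of_length_eq H hy
  rw [h] at this; simp at this; omega

/-- The base oracle reads `𝒪` only at the point of the query. [folklore] -/
theorem baseOracle_congr_point {𝒪 𝒪' : Oracle} (n : ℕ) (s : List Bool) (j : ℕ) (q : List Bool)
    (h : 𝒪 (pointOf n s j q) = 𝒪' (pointOf n s j q)) : baseOracle 𝒪 n s j q = baseOracle 𝒪' n s j q := by
  unfold baseOracle fMid dMath
  unfold pointOf at h
  cases hq : isMQ n q
  · rw [hq] at h
    simp only [Bool.false_eq_true, ↓reduceIte, List.headD_cons, List.tail_cons] at h ⊢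
    rw [h]
  · rw [hq] at h
    simp only [↓reduceIte] at h ⊢
    rw [h]

/-- The verdict with the two test points apart. [folklore] -/
def Vpt (𝒪 : Oracle) (u v z₀ z₁ : List Bool) : Bool :=
  (pbit A E qA P₁ P₂ n 𝒪 u v z₀ == headFn 𝒪 z₀) == (pbit A E qA P₁ P₂ n 𝒪 u v z₁ == headFn 𝒪 z₁)

/-- `Vsem` through `Vpt` (definitional). [folklore] -/
theorem Vsem_eq_Vpt (𝒪 : Oracle) (u zz v : List Bool) :
    Vsem A E qA P₁ P₂ n 𝒪 u zz v = Vpt A E qA P₁ P₂ 𝒪 u v (zz.take n) (zz.drop n) (n := n) := rfl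

/-- **The flip involution preserves a fresh run and flips its verdict.** If the learner's run against the
table `H` never touches the test point `z₀` and `z₀ ≠ z₁`, then against the table flipped at `z₀` the
touched points are the same and the verdict is negated (`ℓ ≥ 1`). [GGM 1986, §3 (a value of a random
function not yet queried is a fresh coin)] [folklore] -/
theorem flipAt_fresh (hℓ : 1 ≤ ℓ) (H : List.Vector Bool n → List.Vector Bool ℓ) (u v : List Bool)
    (z₀ : List.Vector Bool n) (z₁ : List Bool) (hfresh : z₀.toList ∉ ptsOf A qA P₁ (oracleOfTable H) u v (n := n))
    (hne : z₀.toList ≠ z₁) :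
    ptsOf A qA P₁ (oracleOfTable (flipAt z₀ H)) u v (n := n) = ptsOf A qA P₁ (oracleOfTable H) u v (n := n) ∧
      Vpt A E qA P₁ P₂ (oracleOfTable (flipAt z₀ H)) u v z₀.toList z₁ (n := n) =
        !Vpt A E qA P₁ P₂ (oracleOfTable H) u v z₀.toList z₁ (n := n) := by
  set s := v.drop (rulerLen P₁ n) with hs
  have hO : ∀ j q, pointOf n s j q ≠ z₀.toList →
      baseOracle (oracleOfTable H) n s j q = baseOracle (oracleOfTable (flipAt z₀ H)) n s j q :=
    fun j q hj => baseOracle_congr_point n s j q (oracleOfTable_flipAt_of_ne z₀ H hj).symm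
  obtain ⟨hrun, hpts⟩ := runIdxAux_congr_of_points A _ _ (pointOf n s) z₀.toList (xAOf P₁ n u v) hO
    (qA.eval (xAOf P₁ n u v).length) [] hfresh
  have hW : WOf A qA P₁ n (oracleOfTable (flipAt z₀ H)) u v = WOf A qA P₁ n (oracleOfTable H) u v := by
    rw [WOf, WOf, OracleAlg.runIdx, OracleAlg.runIdx, ← hs, hrun]
  refine ⟨hpts.symm, ?_⟩
  have h0 := headFn_oracleOfTable_flipAt_self hℓ z₀ H
  have h1 : headFn (oracleOfTable (flipAt z₀ H)) z₁ = headFn (oracleOfTable H) z₁ := by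
    rw [headFn, headFn, oracleOfTable_flipAt_of_ne z₀ H (Ne.symm hne)]
  simp only [Vpt, pbit, hW, h0, h1]
  generalize (predBit E (T₂Of P₁ P₂ n u) (WOf A qA P₁ n (oracleOfTable H) u v) z₀.toList) = p₀
  generalize headFn (oracleOfTable H) z₀.toList = b₀
  generalize (predBit E (T₂Of P₁ P₂ n u) (WOf A qA P₁ n (oracleOfTable H) u v) z₁ == headFn (oracleOfTable H) z₁) = e₁
  cases p₀ <;> cases b₀ <;> cases e₁ <;> rfl

/-- The freshness condition of the flip argument. [folklore] -/
def Fresh (H : List.Vector Bool n → List.Vector Bool ℓ) (u v z₀ z₁ : List Bool) : Prop :=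
  z₀ ∉ ptsOf A qA P₁ (oracleOfTable H) u v (n := n) ∧ z₀ ≠ z₁

/-- **Among the tables against which the run is fresh, at most half accept** (the flip at `z₀` is a
fixed-point-free involution between fresh-accepting and fresh-rejecting tables). [GGM 1986, §3] [folklore] -/
theorem two_mul_card_accept_fresh_le (hℓ : 1 ≤ ℓ) (u v : List Bool) (z₀ : List.Vector Bool n) (z₁ : List Bool) :
    2 * (univ.filter fun H : List.Vector Bool n → List.Vector Bool ℓ =>
        Fresh A qA P₁ H u v z₀.toList z₁ ∧ Vpt A E qA P₁ P₂ (oracleOfTable H) u v z₀.toList z₁ (n := n) = true).card ≤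
      Fintype.card (List.Vector Bool n → List.Vector Bool ℓ) := by
  set S₁ := univ.filter fun H : List.Vector Bool n → List.Vector Bool ℓ =>
      Fresh A qA P₁ H u v z₀.toList z₁ ∧ Vpt A E qA P₁ P₂ (oracleOfTable H) u v z₀.toList z₁ (n := n) = true with hS₁
  set S₂ := univ.filter fun H : List.Vector Bool n → List.Vector Bool ℓ =>
      Fresh A qA P₁ H u v z₀.toList z₁ ∧ Vpt A E qA P₁ P₂ (oracleOfTable H) u v z₀.toList z₁ (n := n) = false with hS₂
  have hmap : ∀ H : List.Vector Bool n → List.Vector Bool ℓ, Fresh A qA P₁ H u v z₀.toList z₁ →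
      Fresh A qA P₁ (flipAt z₀ H) u v z₀.toList z₁ ∧
        Vpt A E qA P₁ P₂ (oracleOfTable (flipAt z₀ H)) u v z₀.toList z₁ (n := n) =
          !Vpt A E qA P₁ P₂ (oracleOfTable H) u v z₀.toList z₁ (n := n) := by
    intro H hH
    obtain ⟨hpts, hV⟩ := flipAt_fresh A E qA P₁ P₂ hℓ H u v z₀ z₁ hH.1 hH.2
    exact ⟨⟨by rw [hpts]; exact hH.1, hH.2⟩, hV⟩
  have hcard : S₁.card = S₂.card := by
    refine card_nbij' (flipAt z₀) (flipAt z₀) ?_ ?_ (fun H _ => flipAt_flipAt z₀ H) (fun H _ => flipAt_flipAt z₀ H)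
    · intro H hH
      simp only [hS₁, hS₂, mem_coe, mem_filter, mem_univ, true_and] at hH ⊢
      obtain ⟨h1, h2⟩ := hmap H hH.1
      exact ⟨h1, by rw [h2, hH.2]; rfl⟩
    · intro H hH
      simp only [hS₁, hS₂, mem_coe, mem_filter, mem_univ, true_and] at hH ⊢
      obtain ⟨h1, h2⟩ := hmap H hH.1
      exact ⟨h1, by rw [h2, hH.2]; rfl⟩
  have hdisj : Disjoint S₁ S₂ := by
    rw [hS₁, hS₂, disjoint_filter]
    intro H _ h1 h2
    have := h1.2.symm.trans h2.2
    exact Bool.noConfusion this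
  have hle : (S₁ ∪ S₂).card ≤ Fintype.card (List.Vector Bool n → List.Vector Bool ℓ) := card_le_univ _
  rw [card_union_of_disjoint hdisj, ← hcard] at hle
  omega

/-- Hence, over the tables, the number of accepting ones is at most half of all plus the non-fresh ones. [folklore] -/
theorem two_mul_card_accept_le (hℓ : 1 ≤ ℓ) (u v : List Bool) (z₀ : List.Vector Bool n) (z₁ : List Bool) :
    2 * (univ.filter fun H : List.Vector Bool n → List.Vector Bool ℓ =>
        Vpt A E qA P₁ P₂ (oracleOfTable H) u v z₀.toList z₁ (n := n) = true).card ≤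
      Fintype.card (List.Vector Bool n → List.Vector Bool ℓ) +
        2 * (univ.filter fun H : List.Vector Bool n → List.Vector Bool ℓ => ¬Fresh A qA P₁ H u v z₀.toList z₁).card := by
  have h := two_mul_card_accept_fresh_le A E qA P₁ P₂ hℓ u v z₀ z₁
  have hsub : (univ.filter fun H : List.Vector Bool n → List.Vector Bool ℓ =>
        Vpt A E qA P₁ P₂ (oracleOfTable H) u v z₀.toList z₁ (n := n) = true) ⊆
      (univ.filter fun H : List.Vector Bool n → List.Vector Bool ℓ =>
          Fresh A qA P₁ H u v z₀.toList z₁ ∧ Vpt A E qA P₁ P₂ (oracleOfTable H) u v z₀.toList z₁ (n := n) = true) ∪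
        (univ.filter fun H : List.Vector Bool n → List.Vector Bool ℓ => ¬Fresh A qA P₁ H u v z₀.toList z₁) := by
    intro H hH
    simp only [mem_filter, mem_univ, true_and, mem_union] at hH ⊢
    by_cases hF : Fresh A qA P₁ H u v z₀.toList z₁
    · exact Or.inl ⟨hF, hH⟩
    · exact Or.inr hF
  have h2 := (card_le_card hsub).trans (card_union_le _ _)
  omega

/-- The learner's round budget `T' = qA(inputBoundPoly(n))` bounds the number of touched points. [folklore] -/
theorem length_ptsOf_le (𝒪 : Oracle) (u v : List Bool) :
    (ptsOf A qA P₁ 𝒪 u v (n := n)).length ≤ qA.eval ((inputBoundPoly P₁).eval n) := by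
  refine (length_ptsIdxAux_le A _ _ _ _ _).trans (TM2Iter.eval_mono qA ?_)
  have hm : mOf P₁ n u ≤ rulerLen P₁ n := min_le_right _ _
  have h1 : ((v.drop (rulerLen P₁ n - mOf P₁ n u)).take (mOf P₁ n u)).length ≤ rulerLen P₁ n :=
    (List.length_take_le _ _).trans hm
  simp only [xAOf, pacParams, length_boolPair, length_unaryEncodeNat, inputBoundPoly, rulerLen, eval_add, eval_mul,
    eval_ofNat, eval_X, eval_one] at h1 ⊢
  omega

/-- **For a fixed table, the test point is rarely stale**: `z₀`, a fresh uniform block, hits one of the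
`≤ T'` points touched by the learner's run or the other test point with probability `≤ (T' + 1)/2ⁿ`.
[GGM 1986, §3; Arora–Barak 2009, §7.4.1 (fresh coins)] [folklore] -/
theorem uniformProb_not_fresh_le (H : List.Vector Bool n → List.Vector Bool ℓ) (d : ℕ) :
    uniformProb (guessBits P₁ P₂ n + n + d)
        {r | ¬Fresh A qA P₁ H (r.take (guessBits P₁ P₂ n)) ((r.drop (guessBits P₁ P₂ n + n)).drop n)
          ((r.drop (guessBits P₁ P₂ n)).take n) ((r.drop (guessBits P₁ P₂ n + n)).take n)} ≤
      (qA.eval ((inputBoundPoly P₁).eval n) + 1) / 2 ^ n := by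
  refine uniformProb_block_le' (fun u w' => {z | ¬Fresh A qA P₁ H u (w'.drop n) z (w'.take n)}) fun u w' _ _ => ?_
  set pts := ptsOf A qA P₁ (oracleOfTable H) u (w'.drop n) (n := n) with hpts
  have hsub : {z | ¬Fresh A qA P₁ H u (w'.drop n) z (w'.take n)} ⊆ (↑(pts.toFinset ∪ {w'.take n}) : Set (List Bool)) := by
    intro z hz
    simp only [Fresh, Set.mem_setOf_eq, not_and_or, not_not, Ne] at hz
    simp only [coe_union, coe_singleton, Set.mem_union, Set.mem_singleton_iff, List.coe_toFinset, Set.mem_setOf_eq]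
    exact hz
  refine (uniformProb_mono' n hsub).trans ((uniformProb_finset_le n _).trans ?_)
  gcongr
  have h1 : (pts.toFinset ∪ {w'.take n}).card ≤ pts.toFinset.card + 1 := (card_union_le _ _).trans (by simp)
  have h2 : pts.toFinset.card ≤ pts.length := List.toFinset_card_le pts
  have h3 := length_ptsOf_le A qA P₁ (oracleOfTable H) u (w'.drop n) (n := n)
  rw [← hpts] at h3
  exact_mod_cast h1.trans (by omega)

/-- Parsing a full-length coin string for the ideal game: the verdict through `Vpt`. [folklore] -/
theorem verdict_eq_Vpt (𝒪 : Oracle) {d : ℕ} (r : List Bool) (hr : r.length = guessBits P₁ P₂ n + n + (n + d)) :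
    verdict A E qA P₁ P₂ n r 𝒪 =
      Vpt A E qA P₁ P₂ 𝒪 (r.take (guessBits P₁ P₂ n)) ((r.drop (guessBits P₁ P₂ n + n)).drop n)
        ((r.drop (guessBits P₁ P₂ n)).take n) ((r.drop (guessBits P₁ P₂ n + n)).take n) (n := n) := by
  set a := guessBits P₁ P₂ n with ha
  have hsplit : r = r.take a ++ ((r.drop a).take n ++ (r.drop (a + n)).take n) ++ (r.drop (a + n)).drop n := by
    conv_lhs => rw [← List.take_append_drop a r, ← List.take_append_drop n (r.drop a), List.drop_drop,
      ← List.take_append_drop n (r.drop (a + n))]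
    simp only [List.append_assoc]
  have hz0 : ((r.drop a).take n).length = n := by simp; omega
  have hzz : ((r.drop a).take n ++ (r.drop (a + n)).take n).length = 2 * n := by simp; omega
  conv_lhs => rw [hsplit]
  rw [verdict_append A E qA P₁ P₂ (by simp; omega) hzz, Vsem_eq_Vpt, List.take_left' hz0, List.drop_left' hz0]

/-- Double counting: `∑_H #{r | P H r} = ∑_r #{H | P H r}`. [folklore] -/
theorem sum_card_filter_comm {α β : Type*} [Fintype α] [Fintype β] (P : α → β → Prop) [∀ a b, Decidable (P a b)] :
    ∑ a : α, (univ.filter fun b : β => P a b).card = ∑ b : β, (univ.filter fun a : α => P a b).card := by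
  simp_rw [card_filter]
  exact sum_comm

/-- **The ideal game.** Against a uniformly random function table with `ℓ ≥ 1` output bits, the
distinguisher accepts with probability `≤ 1/2 + (T' + 1)/2ⁿ`, `T' = qA(inputBoundPoly(n))` the learner's
round budget (given enough coins: `coinsPoly(n) = L₁ + L₂ + n + (n + d)`). [GGM 1986, §3;
Oliveira–Santhanam 2017, §4 Prop. 1] [folklore] -/
theorem idealProb_le {ℓout : ℕ → ℕ} (hℓ : 1 ≤ ℓout n) {d : ℕ}
    (hC : (coinsPoly qA P₁ P₂).eval n = guessBits P₁ P₂ n + n + (n + d)) :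
    prfIdealProb id ℓout (distinguisher A E qA P₁ P₂) n ≤ 1 / 2 + (qA.eval ((inputBoundPoly P₁).eval n) + 1) / 2 ^ n := by
  -- notation: `a` guess bits, `C` coins
  obtain ⟨a, ha⟩ : ∃ a, a = guessBits P₁ P₂ n := ⟨_, rfl⟩
  obtain ⟨C, hCdef⟩ : ∃ C, C = a + n + (n + d) := ⟨_, rfl⟩
  rw [← ha, ← hCdef] at hC
  -- acceptance probabilities as counts over the coin strings
  have hacc : ∀ H : (List.Vector Bool n → List.Vector Bool (ℓout n)), (distinguisher A E qA P₁ P₂).acceptProb (oracleOfTable H) n * 2 ^ C =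
      ((univ.filter fun r : List.Vector Bool C => verdict A E qA P₁ P₂ n r.toList (oracleOfTable H) = true).card : ℝ) := by
    intro H
    rw [acceptProb_distinguisher, hC, uniformProb, div_mul_cancel₀ _ (by positivity)]
    simp [Set.mem_setOf_eq]
  have hideal : prfIdealProb id ℓout (distinguisher A E qA P₁ P₂) n * ((Fintype.card (List.Vector Bool n → List.Vector Bool (ℓout n)) : ℝ) * 2 ^ C) =
      ∑ H : (List.Vector Bool n → List.Vector Bool (ℓout n)), ((univ.filter fun r : List.Vector Bool C =>
        verdict A E qA P₁ P₂ n r.toList (oracleOfTable H) = true).card : ℝ) := by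
    rw [prfIdealProb_eq_tsum, tsum_fintype, sum_mul]
    refine sum_congr rfl fun H _ => ?_
    change (randomFunctionPMF n (ℓout n) H).toReal * (distinguisher A E qA P₁ P₂).acceptProb (oracleOfTable H) n *
      ((Fintype.card (List.Vector Bool n → List.Vector Bool (ℓout n)) : ℝ) * 2 ^ C) = _
    rw [randomFunctionPMF_apply, ENNReal.toReal_inv, ENNReal.toReal_natCast, ← hacc H]
    have hF : (Fintype.card (List.Vector Bool n → List.Vector Bool (ℓout n)) : ℝ) ≠ 0 := by exact_mod_cast Fintype.card_ne_zero
    field_simp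
    rfl
  -- per coin string: at most half of the tables plus the non-fresh ones accept
  have hkey : ∀ r : List.Vector Bool C,
      2 * (univ.filter fun H : (List.Vector Bool n → List.Vector Bool (ℓout n)) => verdict A E qA P₁ P₂ n r.toList (oracleOfTable H) = true).card ≤
        Fintype.card (List.Vector Bool n → List.Vector Bool (ℓout n)) + 2 * (univ.filter fun H : (List.Vector Bool n → List.Vector Bool (ℓout n)) =>
          ¬Fresh A qA P₁ H (r.toList.take a) ((r.toList.drop (a + n)).drop n) ((r.toList.drop a).take n)
            ((r.toList.drop (a + n)).take n)).card := by
    intro r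
    have hz0 : ((r.toList.drop a).take n).length = n := by simp; omega
    have h := two_mul_card_accept_le A E qA P₁ P₂ hℓ (r.toList.take a) ((r.toList.drop (a + n)).drop n)
      ⟨(r.toList.drop a).take n, hz0⟩ ((r.toList.drop (a + n)).take n) (n := n)
    have hVr : ∀ H : (List.Vector Bool n → List.Vector Bool (ℓout n)), verdict A E qA P₁ P₂ n r.toList (oracleOfTable H) = true ↔
        Vpt A E qA P₁ P₂ (oracleOfTable H) (r.toList.take a) ((r.toList.drop (a + n)).drop n)
          ((r.toList.drop a).take n) ((r.toList.drop (a + n)).take n) (n := n) = true := by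
      intro H
      rw [ha, verdict_eq_Vpt A E qA P₁ P₂ (oracleOfTable H) r.toList (d := d) (by simp [hCdef, ha])]
    rw [filter_congr fun H _ => hVr H]
    exact h
  -- summing over the coin strings
  have hsum : 2 * ∑ H : (List.Vector Bool n → List.Vector Bool (ℓout n)), (univ.filter fun r : List.Vector Bool C =>
        verdict A E qA P₁ P₂ n r.toList (oracleOfTable H) = true).card ≤
      2 ^ C * Fintype.card (List.Vector Bool n → List.Vector Bool (ℓout n)) + 2 * ∑ H : (List.Vector Bool n → List.Vector Bool (ℓout n)), (univ.filter fun r : List.Vector Bool C =>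
        ¬Fresh A qA P₁ H (r.toList.take a) ((r.toList.drop (a + n)).drop n) ((r.toList.drop a).take n)
          ((r.toList.drop (a + n)).take n)).card := by
    rw [sum_card_filter_comm (fun (H : (List.Vector Bool n → List.Vector Bool (ℓout n))) (r : List.Vector Bool C) => verdict A E qA P₁ P₂ n r.toList (oracleOfTable H) = true),
      sum_card_filter_comm (fun (H : (List.Vector Bool n → List.Vector Bool (ℓout n))) (r : List.Vector Bool C) =>
        ¬Fresh A qA P₁ H (r.toList.take a) ((r.toList.drop (a + n)).drop n) ((r.toList.drop a).take n)
          ((r.toList.drop (a + n)).take n)), mul_sum, mul_sum]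
    refine (sum_le_sum fun r _ => hkey r).trans ?_
    rw [sum_add_distrib, sum_const, card_univ, card_vector, Fintype.card_bool, smul_eq_mul]
  -- the non-fresh counts are small
  have hNF : ∀ H : (List.Vector Bool n → List.Vector Bool (ℓout n)), ((univ.filter fun r : List.Vector Bool C =>
        ¬Fresh A qA P₁ H (r.toList.take a) ((r.toList.drop (a + n)).drop n) ((r.toList.drop a).take n)
          ((r.toList.drop (a + n)).take n)).card : ℝ) ≤
      2 ^ C * ((qA.eval ((inputBoundPoly P₁).eval n) + 1) / 2 ^ n) := by
    intro H
    have h := uniformProb_not_fresh_le A qA P₁ P₂ H (n + d) (n := n)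
    rw [← ha, ← hCdef, uniformProb, div_le_iff₀ (by positivity)] at h
    rw [mul_comm]
    refine le_trans (le_of_eq ?_) h
    simp [Set.mem_setOf_eq]
  have hF : (0 : ℝ) < Fintype.card (List.Vector Bool n → List.Vector Bool (ℓout n)) := by exact_mod_cast Fintype.card_pos
  have hsumR : (2 : ℝ) * ∑ H : (List.Vector Bool n → List.Vector Bool (ℓout n)), ((univ.filter fun r : List.Vector Bool C =>
        verdict A E qA P₁ P₂ n r.toList (oracleOfTable H) = true).card : ℝ) ≤
      2 ^ C * Fintype.card (List.Vector Bool n → List.Vector Bool (ℓout n)) + 2 * ∑ H : (List.Vector Bool n → List.Vector Bool (ℓout n)), ((univ.filter fun r : List.Vector Bool C =>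
        ¬Fresh A qA P₁ H (r.toList.take a) ((r.toList.drop (a + n)).drop n) ((r.toList.drop a).take n)
          ((r.toList.drop (a + n)).take n)).card : ℝ) := by
    exact_mod_cast hsum
  have hsumNF : ∑ H : (List.Vector Bool n → List.Vector Bool (ℓout n)), ((univ.filter fun r : List.Vector Bool C =>
        ¬Fresh A qA P₁ H (r.toList.take a) ((r.toList.drop (a + n)).drop n) ((r.toList.drop a).take n)
          ((r.toList.drop (a + n)).take n)).card : ℝ) ≤
      Fintype.card (List.Vector Bool n → List.Vector Bool (ℓout n)) * (2 ^ C * ((qA.eval ((inputBoundPoly P₁).eval n) + 1) / 2 ^ n)) := by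
    refine (sum_le_sum fun H _ => hNF H).trans ?_
    rw [sum_const, card_univ, nsmul_eq_mul]
  rw [← hideal] at hsumR
  have h2C : (0 : ℝ) < 2 ^ C := by positivity
  have h2n : (0 : ℝ) < 2 ^ n := by positivity
  have hFC : (0 : ℝ) < (Fintype.card (List.Vector Bool n → List.Vector Bool (ℓout n)) : ℝ) * 2 ^ C := by positivity
  -- divide by `|(List.Vector Bool n → List.Vector Bool (ℓout n))| · 2^C`
  have hmain : prfIdealProb id ℓout (distinguisher A E qA P₁ P₂) n * ((Fintype.card (List.Vector Bool n → List.Vector Bool (ℓout n)) : ℝ) * 2 ^ C) ≤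
      (1 / 2 + (qA.eval ((inputBoundPoly P₁).eval n) + 1) / 2 ^ n) * ((Fintype.card (List.Vector Bool n → List.Vector Bool (ℓout n)) : ℝ) * 2 ^ C) := by
    have hTb : (0 : ℝ) ≤ (qA.eval ((inputBoundPoly P₁).eval n) + 1) / 2 ^ n := by positivity
    nlinarith [hsumR, hsumNF]
  exact le_of_mul_le_mul_right hmain hFC

end IdealGame

end LearnerDistinguisher

end Literature.Computability.Learning
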